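import Mathlib.Data.Fin.Tuple.Sort
import Mathlib.Order.WellFounded
import Summits.CriticalPhenomena.PercolationContinuityZ3.Theorems.PercNearOneGluingNoHeavyLowerTailSahiSlotPatternPositivity

/-!
# Rectangular pattern sums reduce to square ones: `m` slots on the big cube `[N]^d`

Support file (lane `prim-masterthm-p3`, generation 18; `--supports stmt-CriticalPhenomena-4575`).  Pure proofs, no definitions,
no `sorry`, standard axioms.

The pattern functional `patternForm d m` lives on the cube `[m]^d` with as many slots as the side.  Block expansions through a slot
(the profile / SIGN law, Sahi's branching rule) produce sums of the diagonal form over slot families with FEWER slots than the side: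
`Σ_{u} diagForm d m (h ∘ slot_u)` over the families `u : Fin d → Fin m → Fin N` that are INJECTIVE on every axis.  This file reduces
them to the square functional: every injective `u_a` factors uniquely as (strictly monotone) ∘ (permutation) (`Tuple.sort`,
`StrictMono.range_inj`), and the diagonal form symmetrised over the permutations is `patternForm` of the pulled-back family, so
  `Σ_{u injective} diagForm d m (h ∘ slot_u) = Σ_{v strictly monotone} patternForm d m (h ∘ slot_v)`   (`sum_inj_diagForm_eq_sum_mono_patternForm`),
and along a monotone `slot_v` up-sets pull back to up-sets, whence
  `SlotPatternPos d m ⟹ Σ_{u injective} diagForm d m (1_U ∘ slot_u) ≥ 0` for up-sets `U_i ⊆ [N]^d`   (`sum_inj_diagForm_nonneg`).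
This is the "deletion / restriction to sub-boxes" step of the lane's SIGN⁻ law and branching rule (HIERARCHY §26(e)), isolated as a
reusable identity. [this work]
-/

namespace Summit.CriticalPhenomena.PercolationContinuityZ3.Theorems

open Finset Function Equiv Equiv.Perm
open Literature.Combinatorics.Sahi2008

namespace SahiSlot

section Restrict

open scoped Classical

variable {d m N : ℕ}

/-- **Unique factorisation of injective slot families**: the map `(v, σ) ↦ v ∘ σ` is a bijection from
(strictly monotone families) × `S_m^d` onto the families injective on every axis — stated as an image identity plus injectivity.
[this work] -/
theorem image_combFam_eq :
    ((univ.filter fun v : Fin d → Fin m → Fin N => ∀ a, StrictMono (v a)) ×ˢ (univ : Finset (Fin d → Perm (Fin m)))).image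
        (fun x : (Fin d → Fin m → Fin N) × (Fin d → Perm (Fin m)) => fun a => x.1 a ∘ x.2 a) =
      univ.filter fun u : Fin d → Fin m → Fin N => ∀ a, Injective (u a) := by
  ext u
  simp only [mem_image, mem_product, mem_filter, mem_univ, true_and, and_true]
  constructor
  · rintro ⟨⟨v, σ⟩, hv, rfl⟩ a
    exact (hv a).injective.comp (σ a).injective
  · intro hu
    -- sort every axis
    refine ⟨⟨fun a => u a ∘ Tuple.sort (u a), fun a => (Tuple.sort (u a))⁻¹⟩, fun a => ?_, ?_⟩
    · exact (Tuple.monotone_sort (u a)).strictMono_of_injective ((hu a).comp (Tuple.sort (u a)).injective)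
    · funext a i
      show u a (Tuple.sort (u a) ((Tuple.sort (u a))⁻¹ i)) = u a i
      rw [Perm.inv_def, Equiv.apply_symm_apply]

/-- Injectivity of the factorisation. [this work] -/
theorem combFam_injOn :
    Set.InjOn (fun x : (Fin d → Fin m → Fin N) × (Fin d → Perm (Fin m)) => fun a => x.1 a ∘ x.2 a)
      ↑((univ.filter fun v : Fin d → Fin m → Fin N => ∀ a, StrictMono (v a)) ×ˢ (univ : Finset (Fin d → Perm (Fin m)))) := by
  rintro ⟨v, σ⟩ hv ⟨v', σ'⟩ hv' h
  simp only [coe_product, coe_filter, coe_univ, Set.mem_prod, Set.mem_setOf_eq, Set.mem_univ, and_true, mem_univ,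
    true_and] at hv hv'
  have hax : ∀ a, v a ∘ σ a = v' a ∘ σ' a := fun a => congrFun h a
  have hv_eq : v = v' := by
    funext a
    have hrange : Set.range (v a) = Set.range (v' a) := by
      have h1 : Set.range (v a ∘ σ a) = Set.range (v a) := (σ a).surjective.range_comp _
      have h2 : Set.range (v' a ∘ σ' a) = Set.range (v' a) := (σ' a).surjective.range_comp _
      rw [← h1, ← h2, hax a]
    exact ((hv a).range_inj (hv' a)).1 hrange
  subst hv_eq
  have hσ : σ = σ' := by
    funext a
    ext i
    have := congrFun (hax a) i
    simp only [comp_apply] at this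
    exact congrArg Fin.val ((hv a).injective this)
  rw [hσ]

/-- **Re-indexing a sum over injective slot families by (monotone skeleton, permutations).** [this work] -/
theorem sum_inj_eq_sum_mono_perm (Φ : (Fin d → Fin m → Fin N) → ℝ) :
    ∑ u ∈ univ.filter (fun u : Fin d → Fin m → Fin N => ∀ a, Injective (u a)), Φ u =
      ∑ v ∈ univ.filter (fun v : Fin d → Fin m → Fin N => ∀ a, StrictMono (v a)),
        ∑ σ : Fin d → Perm (Fin m), Φ (fun a => v a ∘ σ a) := by
  rw [← image_combFam_eq, sum_image combFam_injOn, sum_product]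

/-- **RECTANGULAR = Σ SQUARE**: the diagonal form summed over the injective `m`-slot families of `[N]^d` is the pattern functional
summed over the monotone skeletons: `Σ_{u inj} D(h ∘ slot_u) = Σ_{v mono} patternForm d m (h ∘ slot_v)`. [this work] -/
theorem sum_inj_diagForm_eq_sum_mono_patternForm (h : Fin m → Q d N → ℝ) :
    ∑ u ∈ univ.filter (fun u : Fin d → Fin m → Fin N => ∀ a, Injective (u a)), diagForm d m (fun i => h i ∘ slotMap u) =
      ∑ v ∈ univ.filter (fun v : Fin d → Fin m → Fin N => ∀ a, StrictMono (v a)),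
        patternForm d m (fun i => h i ∘ slotMap v) := by
  rw [sum_inj_eq_sum_mono_perm]
  refine sum_congr rfl fun v _ => ?_
  unfold patternForm
  refine sum_congr rfl fun σ _ => ?_
  rw [slotMap_comp_act]
  rfl

/-- **Positivity of rectangular pattern sums from the square cell**: if `SlotPatternPos d m` holds then for up-sets
`U_i ⊆ [N]^d`, `Σ_{u injective} diagForm d m (1_U ∘ slot_u) ≥ 0`. [this work] -/
theorem sum_inj_diagForm_nonneg (hP : SlotPatternPos d m) (U : Fin m → Finset (Q d N))
    (hU : ∀ i, IsUpperSet (U i : Set (Q d N))) :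
    0 ≤ ∑ u ∈ univ.filter (fun u : Fin d → Fin m → Fin N => ∀ a, Injective (u a)),
      diagForm d m (fun i => setInd (U i) ∘ slotMap u) := by
  rw [sum_inj_diagForm_eq_sum_mono_patternForm]
  refine sum_nonneg fun v hv => ?_
  rw [mem_filter] at hv
  have hmono : ∀ a, Monotone (v a) := fun a => (hv.2 a).monotone
  simp_rw [setInd_comp_slotMap]
  exact hP _ fun i => isUpperSet_pullSet hmono (hU i)

end Restrict

end SahiSlot

end Summit.CriticalPhenomena.PercolationContinuityZ3.Theorems
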